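import Summits.BirchSwinnertonDyer.BirchSwinnertonDyer.Theorems.ByReductionTypeAtTwoRankOneSigmaSqThetaPoints
import HarnessLib

/-!
# Route `ByReductionTypeAtTwo`, crux `RankOneAtTwoBigImageOddLocal` (item stmt-BirchSwinnertonDyer-23715), line AN62, σ₀-LEMMA BLOCK
# (cell `bsd-f1-sign2`, planner seat `-an` g49; `--supports 23715`, helper): **a `2`-adic height datum whose quadratic form is the
# naive-σ height `log₂ den x(P) − log₂ Σ₀(z(P))` — EXISTS at a supersingular `2`** (item 50D `EtaHeightDataExistsAtTwo`, generic form)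

HONEST FRAMING (D-0036/D-0054): THEOREMS ONLY (no definition, no named fact, no `sorry`, no instance); `p`-adic analysis and the
algebra of quadratic forms on `E(ℚ)`, NOT a statement about `BSDp`; item 23715 stays OPEN; BSD is proved for no curve.  What is
constructed is a symmetric bilinear torsion-killing pairing `E(ℚ) × E(ℚ) → ℚ₂` (the tree's `PAdicHeightData W 2`) with a PRESCRIBED
quadratic form on the local-conditions locus; that this datum is the `η`-component of the Bernardi–Perrin-Riou `D_dR`-valued height
(the dictionary half of 50D) is NOT claimed here.

For `W/ℚ` elliptic with `ℤ`-integral equation and `a₁ = 0`, and `Σ₀ ∈ ℚ₂⟦t⟧` the even constant-`0` normalised solution of the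
sigma-squared equation of `W ⊗ ℚ₂` (`[t⁰] = [t¹] = [t³] = 0`, `[t²] = 1`, `SatisfiesSigmaSqODE Σ₀ 0`; exists uniquely,
`existsUnique_isFormallyEven_satisfiesSigmaSqODE_zero`; converges exactly on `v₂(t) > 1`, Bernardi 1981 §1):
* §1 `norm_coeff_sigmaShift_sigmaShift_le_rat` (53D over `ℚ`), **`padicEval_sigmaSqZero_ne_zero_two`**: `Σ₀(t) ≠ 0` for
  `0 < ‖t‖₂ < ½` (`Σ₀(t) = t²·S(t)`, `S(2·) ∈ 1 + w ℤ₂⟦w⟧`).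
* §2 **`sigmaSqZero_height_parallelogram_two`** — the PARALLELOGRAM LAW of `h(P) := log₂ den x(P) − log₂ Σ₀(z(P))` for `P, Q`
  in the local-conditions locus at `2` (`‖x‖₂ > 1`, `‖z‖₂ < ½`, non-singular reduction at every prime) with `P ≠ ±Q`:
  `h(P+Q) + h(P−Q) = 2h(P) + 2h(Q)` — Néron's denominator law `d₃d₄ = d₁²d₂²δ²` (tree `den_mul_den_eq`) against the squared theta
  relation at points for the NON-integral `Σ₀` (`sigmaSqZero_theta_points_two`, by rescaling the formal group).  This is
  Mazur–Stein–Tate's «`h_ρ` is quadratic because of property IV of `σ`» for the naive (algebraic-splitting) `σ` at a SUPERSINGULAR `2`.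
* §3 **`exists_heightData_sigmaSqZero_two`** — a `D : PAdicHeightData W 2` with `⟨P, P⟩_D = log₂ den x(P) − log₂ Σ₀(z(P))` on the
  local-conditions locus (torsion-free subgroup `{O} ∪ locus`, `parallelogram_of_generic`, Jordan–von Neumann
  `exists_pairing_of_parallelogram` — the tree's `exists_isCanonicalSq_of_exists` run on `Σ₀` instead of an integral pair, of
  which there is none at supersingular `2`).

References: [cite: MazurSteinTate2006, §1, §2.6–2.7, §4 (heights attached to a splitting)] [cite: MazurTate1991, Thm. 3.1]
[cite: Bernardi1981, §1] [cite: PerrinRiou1984, §II (naive heights at supersingular primes)] [cite: SteinWuthrich2013, §4.1 eq. (4.1)].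
-/

set_option autoImplicit false

noncomputable section

open scoped Classical

open PowerSeries WeierstrassCurve Literature.NumberTheory.EllipticCurves

namespace Summit.BirchSwinnertonDyer.BirchSwinnertonDyer.Theorems

namespace NaiveSigmaLogAtTwo

/-! ### §1 Non-vanishing of `Σ₀` on the punctured sigma disc -/

/-- 53D over `ℚ`: `‖[tⁿ](Σ₀/t²)‖₂ ≤ 2ⁿ` for the `ℤ`-integral `ℚ`-curve `W` with `a₁ = 0`. [cite: Bernardi1981, §1] -/
theorem norm_coeff_sigmaShift_sigmaShift_le_rat (W : WeierstrassCurve ℚ) [W.IsIntegral ℤ] (ha1 : W.a₁ = 0) (Sq : ℚ_[2]⟦X⟧)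
    (h2 : coeff 2 Sq = 1) (h3 : coeff 3 Sq = 0) (hODE : (W.baseChange ℚ_[2]).SatisfiesSigmaSqODE Sq 0) (n : ℕ) :
    ‖coeff n (sigmaShift (sigmaShift Sq))‖ ≤ 2 ^ n := by
  obtain ⟨e1, e2, e3, e4, e6⟩ := baseChange_padic_two_a W
  have ha1' : (W.baseChange ℚ_[2]).a₁ = 0 := by rw [e1, ha1, Rat.cast_zero]
  have ha2 : ‖(W.baseChange ℚ_[2]).a₂‖ ≤ 1 := by rw [e2]; exact (mem_localIntegers_iff 2 _).mp (W.a₂_mem_localIntegers 2)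
  have ha3 : ‖(W.baseChange ℚ_[2]).a₃‖ ≤ 1 := by rw [e3]; exact (mem_localIntegers_iff 2 _).mp (W.a₃_mem_localIntegers 2)
  have ha4 : ‖(W.baseChange ℚ_[2]).a₄‖ ≤ 1 := by rw [e4]; exact (mem_localIntegers_iff 2 _).mp (W.a₄_mem_localIntegers 2)
  have ha6 : ‖(W.baseChange ℚ_[2]).a₆‖ ≤ 1 := by rw [e6]; exact (mem_localIntegers_iff 2 _).mp (W.a₆_mem_localIntegers 2)
  obtain ⟨L, hL0, hL⟩ := exists_sigmaLog_two Sq h2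
  exact norm_coeff_sigmaShift_sigmaShift_le (W.baseChange ℚ_[2]) Sq L ha1' ha2 ha3 ha4 ha6 h2 h3 hODE hL0 hL n

/-- **`Σ₀(t) ≠ 0` for `0 < ‖t‖₂ < ½`**: `Σ₀(t) = t²·S(t)` with `S(2w) ∈ 1 + wℤ₂⟦w⟧`, so `‖S(t) − 1‖₂ < 1`. [cite: Bernardi1981, §1] -/
theorem padicEval_sigmaSqZero_ne_zero_two (W : WeierstrassCurve ℚ) [W.IsIntegral ℤ] (ha1 : W.a₁ = 0) (Sq : ℚ_[2]⟦X⟧)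
    (h0 : constantCoeff Sq = 0) (h1 : coeff 1 Sq = 0) (h2 : coeff 2 Sq = 1) (h3 : coeff 3 Sq = 0)
    (hODE : (W.baseChange ℚ_[2]).SatisfiesSigmaSqODE Sq 0) {t : ℚ_[2]} (ht0 : t ≠ 0) (ht : ‖t‖ < 2⁻¹) :
    padicEval Sq t ≠ 0 := by
  have hSb := norm_coeff_sigmaShift_sigmaShift_le_rat W ha1 Sq h2 h3 hODE
  set S := sigmaShift (sigmaShift Sq) with hSdef
  have hSq : Sq = X * (X * S) := by
    rw [hSdef, X_mul_sigmaShift (by rw [constantCoeff_sigmaShift, h1]), X_mul_sigmaShift h0]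
  have h2n : ‖(2 : ℚ_[2])‖ = 2⁻¹ := by exact_mod_cast (Padic.norm_p (p := 2))
  have h20 : (2 : ℚ_[2]) ≠ 0 := two_ne_zero
  have h2i : ‖(2 : ℚ_[2])‖ ≤ 1 := by rw [h2n]; norm_num
  -- `S(2w)` is integral with constant term `1`
  have hSi : IsPadicInt (rescale (2 : ℚ_[2]) S) := by
    rw [isPadicInt_iff_coeff]
    intro n
    rw [coeff_rescale, norm_mul, norm_pow, h2n]
    calc (2⁻¹ : ℝ) ^ n * ‖coeff n S‖ ≤ (2⁻¹ : ℝ) ^ n * 2 ^ n := by gcongr; exact hSb n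
      _ = 1 := by rw [← mul_pow, inv_mul_cancel₀ (two_ne_zero : (2 : ℝ) ≠ 0), one_pow]
  have hS0 : constantCoeff (rescale (2 : ℚ_[2]) S) = 1 := by
    rw [← coeff_zero_eq_constantCoeff_apply, coeff_rescale, pow_zero, one_mul, coeff_zero_eq_constantCoeff_apply, hSdef,
      constantCoeff_sigmaShift, coeff_sigmaShift, h2]
  -- the point `w = t/2`
  set w : ℚ_[2] := 2⁻¹ * t with hwdef
  have hw : ‖w‖ < 1 := by
    rw [hwdef, norm_mul, norm_inv, h2n, inv_inv]
    calc (2 : ℝ) * ‖t‖ < 2 * 2⁻¹ := by gcongr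
      _ = 1 := by norm_num
  have hw0 : w ≠ 0 := mul_ne_zero (inv_ne_zero h20) ht0
  have hresc : rescale (2 : ℚ_[2]) Sq = (C (2 : ℚ_[2]) * X) * ((C (2 : ℚ_[2]) * X) * rescale (2 : ℚ_[2]) S) := by
    rw [hSq, map_mul, map_mul, rescale_X]
  have hev : padicEval Sq t = padicEval (rescale (2 : ℚ_[2]) Sq) w := by
    rw [padicEval_rescale, hwdef, mul_inv_cancel_left₀ h20]
  have hCX : IsPadicInt (C (2 : ℚ_[2]) * X : ℚ_[2]⟦X⟧) := (IsPadicInt.powerSeries_C h2i).mul IsPadicInt.powerSeries_X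
  have hS1 : padicEval (rescale (2 : ℚ_[2]) S) w ≠ 0 := by
    intro hz
    have hlt := norm_padicEval_lt_one (hSi.sub IsPadicInt.one) (by rw [map_sub, hS0, map_one, sub_self]) hw
    rw [padicEval_sub hSi IsPadicInt.one hw, padicEval_one, hz, zero_sub, norm_neg, norm_one] at hlt
    exact lt_irrefl _ hlt
  rw [hev, hresc, padicEval_mul hCX (hCX.mul hSi) hw, padicEval_mul hCX hSi hw,
    padicEval_mul (IsPadicInt.powerSeries_C h2i) IsPadicInt.powerSeries_X hw, padicEval_C, padicEval_X]
  exact mul_ne_zero (mul_ne_zero h20 hw0) (mul_ne_zero (mul_ne_zero h20 hw0) hS1)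

/-! ### §2 The parallelogram law of the naive-σ height on the local-conditions locus at `2` -/

/-- The sigma disc at `2` is `‖z‖₂ < ½`. -/
theorem norm_lt_half_of_inSigmaDisc_two {z : ℚ_[2]} (h : InSigmaDisc 2 z) : ‖z‖ < 2⁻¹ := by
  unfold InSigmaDisc at h
  have hrad : ((2 : ℕ) : ℝ) ^ (-(1 / (((2 : ℕ) : ℝ) - 1))) = 2⁻¹ := by
    rw [show (-(1 / (((2 : ℕ) : ℝ) - 1))) = (-1 : ℝ) by norm_num, Nat.cast_ofNat, Real.rpow_neg_one]
  rwa [hrad] at h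

/-- **PARALLELOGRAM LAW of `h(P) = log₂ den x(P) − log₂ Σ₀(z(P))`** on the local-conditions locus at `2` (`ℤ`-integral `W/ℚ`,
`a₁ = 0`, `Σ₀` the naive even sigma-squared series): for `P = (x₁,y₁)`, `Q = (x₂,y₂)` in the locus with `P + Q = (x₃,y₃)`,
`P − Q = (x₄,y₄)` affine, `h(P+Q) + h(P−Q) = 2h(P) + 2h(Q)`.  Denominators: Néron's law `d₃d₄ = d₁²d₂²(x₁−x₂)²` (`den_mul_den_eq`);
sigma: `Σ₀(z₃)Σ₀(z₄) = (x₂−x₁)²Σ₀(z₁)²Σ₀(z₂)²` (`sigmaSqZero_theta_points_two`). [cite: MazurSteinTate2006, §2.6–2.7]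
[cite: MazurTate1991, Thm. 3.1] [cite: Bernardi1981, §1] -/
theorem sigmaSqZero_height_parallelogram_two (W : WeierstrassCurve ℚ) [W.IsElliptic] [W.IsIntegral ℤ] (ha1 : W.a₁ = 0)
    (Sq : ℚ_[2]⟦X⟧) (h0 : constantCoeff Sq = 0) (h1 : coeff 1 Sq = 0) (h2 : coeff 2 Sq = 1) (h3 : coeff 3 Sq = 0)
    (hODE : (W.baseChange ℚ_[2]).SatisfiesSigmaSqODE Sq 0)
    {x₁ y₁ x₂ y₂ x₃ y₃ x₄ y₄ : ℚ} (h₁ : W.toAffine.Nonsingular x₁ y₁) (h₂ : W.toAffine.Nonsingular x₂ y₂)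
    (h₃ : W.toAffine.Nonsingular x₃ y₃) (h₄ : W.toAffine.Nonsingular x₄ y₄)
    (hP : W.SatisfiesLocalConditions 2 (.some x₁ y₁ h₁)) (hQ : W.SatisfiesLocalConditions 2 (.some x₂ y₂ h₂))
    (hS : (.some x₁ y₁ h₁ : W.toAffine.Point) + .some x₂ y₂ h₂ = .some x₃ y₃ h₃)
    (hD : (.some x₁ y₁ h₁ : W.toAffine.Point) - .some x₂ y₂ h₂ = .some x₄ y₄ h₄) :
    (padicLog 2 ((x₃.den : ℚ) : ℚ_[2]) - padicLog 2 (padicEval Sq (-(x₃ : ℚ_[2]) / y₃))) +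
        (padicLog 2 ((x₄.den : ℚ) : ℚ_[2]) - padicLog 2 (padicEval Sq (-(x₄ : ℚ_[2]) / y₄))) =
      2 * (padicLog 2 ((x₁.den : ℚ) : ℚ_[2]) - padicLog 2 (padicEval Sq (-(x₁ : ℚ_[2]) / y₁))) +
        2 * (padicLog 2 ((x₂.den : ℚ) : ℚ_[2]) - padicLog 2 (padicEval Sq (-(x₂ : ℚ_[2]) / y₂))) := by
  have hmul : padicLog_mul 2 := padicLog_mul_holds 2
  -- the locus is a subgroup: `P ± Q` satisfy the local conditions
  obtain ⟨H, hH⟩ := W.exists_addSubgroup_coe_eq_localConditionsLocus_of_isIntegral 2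
  have hmem : ∀ R, R ∈ H ↔ R = 0 ∨ W.SatisfiesLocalConditions 2 R := fun R => by
    rw [← SetLike.mem_coe, hH]; rfl
  have hPH : (.some x₁ y₁ h₁ : W.toAffine.Point) ∈ H := (hmem _).mpr (Or.inr hP)
  have hQH : (.some x₂ y₂ h₂ : W.toAffine.Point) ∈ H := (hmem _).mpr (Or.inr hQ)
  have hadd : (.some x₁ y₁ h₁ : W.toAffine.Point) + .some x₂ y₂ h₂ ≠ 0 := by rw [hS]; exact fun h => by cases h
  have hsub : (.some x₁ y₁ h₁ : W.toAffine.Point) - .some x₂ y₂ h₂ ≠ 0 := by rw [hD]; exact fun h => by cases h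
  have hS' : W.SatisfiesLocalConditions 2 (.some x₃ y₃ h₃) := by
    have := ((hmem _).mp (H.add_mem hPH hQH)).resolve_left hadd
    rwa [hS] at this
  have hD' : W.SatisfiesLocalConditions 2 (.some x₄ y₄ h₄) := by
    have := ((hmem _).mp (H.sub_mem hPH hQH)).resolve_left hsub
    rwa [hD] at this
  have hx : x₁ ≠ x₂ := X_ne_of_sub_ne_zero_of_add_ne_zero h₁ h₂ hsub hadd
  obtain ⟨hx₁, hd₁, hns₁⟩ := hP
  obtain ⟨hx₂, hd₂, hns₂⟩ := hQ
  obtain ⟨hx₃, hd₃, hns₃⟩ := hS'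
  obtain ⟨hx₄, hd₄, hns₄⟩ := hD'
  have hz₁ := norm_lt_half_of_inSigmaDisc_two hd₁
  have hz₂ := norm_lt_half_of_inSigmaDisc_two hd₂
  have hz₃ := norm_lt_half_of_inSigmaDisc_two hd₃
  have hz₄ := norm_lt_half_of_inSigmaDisc_two hd₄
  -- the squared theta relation at points and the denominator identity
  have hθ' := sigmaSqZero_theta_points_two W ha1 Sq h0 h1 h2 h3 hODE h₁ h₂ hx₁ hx₂ hz₁ hz₂
  rw [hS, hD] at hθ'
  simp only [padicParam_some] at hθ'
  have hden' := den_mul_den_eq padicValNat_den_parallelogram_holds W h₁ h₂ h₃ h₄ hx hS hD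
    fun ℓ hℓ => ⟨hns₁ ℓ hℓ, hns₂ ℓ hℓ, hns₃ ℓ hℓ, hns₄ ℓ hℓ⟩
  have hdenp : ((x₃.den : ℚ) : ℚ_[2]) * ((x₄.den : ℚ) : ℚ_[2]) =
      ((x₁.den : ℚ) : ℚ_[2]) ^ 2 * ((x₂.den : ℚ) : ℚ_[2]) ^ 2 * ((x₁ : ℚ_[2]) - x₂) ^ 2 := by
    have := congrArg (fun q : ℚ => (q : ℚ_[2])) hden'
    push_cast at this ⊢
    exact this
  -- non-vanishing
  have hz0 : ∀ {x y : ℚ} (h : W.toAffine.Nonsingular x y), 1 < ‖(x : ℚ_[2])‖ → -(x : ℚ_[2]) / y ≠ 0 :=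
    fun h hx => ((W.baseChange ℚ_[2]).param_facts (nonsingular_ratCast (p := 2) h).1 hx).2.1
  have hS₁ := padicEval_sigmaSqZero_ne_zero_two W ha1 Sq h0 h1 h2 h3 hODE (hz0 h₁ hx₁) hz₁
  have hS₂ := padicEval_sigmaSqZero_ne_zero_two W ha1 Sq h0 h1 h2 h3 hODE (hz0 h₂ hx₂) hz₂
  have hS₃ := padicEval_sigmaSqZero_ne_zero_two W ha1 Sq h0 h1 h2 h3 hODE (hz0 h₃ hx₃) hz₃
  have hS₄ := padicEval_sigmaSqZero_ne_zero_two W ha1 Sq h0 h1 h2 h3 hODE (hz0 h₄ hx₄) hz₄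
  have hd : ∀ x : ℚ, ((x.den : ℚ) : ℚ_[2]) ≠ 0 := fun x => by exact_mod_cast x.den_nz
  have hδ : (x₁ : ℚ_[2]) - x₂ ≠ 0 := sub_ne_zero.mpr (by exact_mod_cast hx)
  have hδ' : (x₂ : ℚ_[2]) - x₁ ≠ 0 := by rw [← neg_sub]; exact neg_ne_zero.mpr hδ
  -- logarithms
  have hlogd : padicLog 2 ((x₃.den : ℚ) : ℚ_[2]) + padicLog 2 ((x₄.den : ℚ) : ℚ_[2]) =
      2 * padicLog 2 ((x₁.den : ℚ) : ℚ_[2]) + 2 * padicLog 2 ((x₂.den : ℚ) : ℚ_[2]) +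
        2 * padicLog 2 ((x₁ : ℚ_[2]) - x₂) := by
    rw [← hmul (hd x₃) (hd x₄), hdenp, hmul (mul_ne_zero (pow_ne_zero 2 (hd x₁))
      (pow_ne_zero 2 (hd x₂))) (pow_ne_zero 2 hδ), hmul (pow_ne_zero 2 (hd x₁))
      (pow_ne_zero 2 (hd x₂)), padicLog_sq (hd x₁), padicLog_sq (hd x₂), padicLog_sq hδ]
  have hlogS : padicLog 2 (padicEval Sq (-(x₃ : ℚ_[2]) / y₃)) + padicLog 2 (padicEval Sq (-(x₄ : ℚ_[2]) / y₄)) =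
      2 * padicLog 2 ((x₁ : ℚ_[2]) - x₂) + 2 * padicLog 2 (padicEval Sq (-(x₁ : ℚ_[2]) / y₁)) +
        2 * padicLog 2 (padicEval Sq (-(x₂ : ℚ_[2]) / y₂)) := by
    rw [← hmul hS₃ hS₄, hθ', hmul (mul_ne_zero (pow_ne_zero 2 hδ') (pow_ne_zero 2 hS₁))
      (pow_ne_zero 2 hS₂), hmul (pow_ne_zero 2 hδ') (pow_ne_zero 2 hS₁), padicLog_sq hS₁,
      padicLog_sq hS₂, padicLog_sq hδ', ← neg_sub, padicLog_neg hδ]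
  linear_combination hlogd - hlogS

/-! ### §3 Existence of the height datum -/

/-- **A `2`-ADIC HEIGHT DATUM WITH QUADRATIC FORM `log₂ den x − log₂ Σ₀(z)` EXISTS** (item 50D, generic form).  `W/ℚ` elliptic with
`ℤ`-integral equation and `a₁ = 0`; `Σ₀` the naive even sigma-squared series of `W ⊗ ℚ₂`.  THEN there is a symmetric bilinear
torsion-killing pairing `D : PAdicHeightData W 2` with `⟨P, P⟩_D = log₂ den x(P) − log₂ Σ₀(z(P))` for every `P` in the
local-conditions locus at `2` (`‖x‖₂ > 1`, `‖z‖₂ < ½`, non-singular reduction at every prime).  Parallelogram law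
(`sigmaSqZero_height_parallelogram_two`) on the torsion-free subgroup `{O} ∪ locus`, generic pairs to all pairs
(`parallelogram_of_generic`), Jordan–von Neumann (`exists_pairing_of_parallelogram`).  At a good SUPERSINGULAR `2` no `2`-integral
sigma pair exists, so this is the first `PAdicHeightData W 2` with a σ-type quadratic form there; it is the receptacle of the
`η = xω`-component of the Bernardi–Perrin-Riou height (not claimed). [cite: MazurSteinTate2006, §1, §2.7, §4]
[cite: PerrinRiou1984, §II] [cite: Bernardi1981, §1] -/
theorem exists_heightData_sigmaSqZero_two (W : WeierstrassCurve ℚ) [W.IsElliptic] [W.IsIntegral ℤ] (ha1 : W.a₁ = 0)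
    (Sq : ℚ_[2]⟦X⟧) (h0 : constantCoeff Sq = 0) (h1 : coeff 1 Sq = 0) (h2 : coeff 2 Sq = 1) (h3 : coeff 3 Sq = 0)
    (hODE : (W.baseChange ℚ_[2]).SatisfiesSigmaSqODE Sq 0) :
    ∃ D : PAdicHeightData W 2, ∀ {x y : ℚ} (h : W.toAffine.Nonsingular x y), W.SatisfiesLocalConditions 2 (.some x y h) →
      D.pairing (.some x y h) (.some x y h) =
        padicLog 2 ((x.den : ℚ) : ℚ_[2]) - padicLog 2 (padicEval Sq (-(x : ℚ_[2]) / y)) := by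
  let q : W.toAffine.Point → ℚ_[2] := fun R => match R with
    | .zero => 0
    | .some x y _ => padicLog 2 ((x.den : ℚ) : ℚ_[2]) - padicLog 2 (padicEval Sq (-(x : ℚ_[2]) / y))
  obtain ⟨H, hH⟩ := W.exists_addSubgroup_coe_eq_localConditionsLocus_of_isIntegral 2
  have hmem : ∀ P, P ∈ H ↔ P = 0 ∨ W.SatisfiesLocalConditions 2 P := fun P => by
    rw [← SetLike.mem_coe, hH]; rfl
  have hslc : ∀ P ∈ H, P ≠ 0 → W.SatisfiesLocalConditions 2 P := fun P hP hne =>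
    ((hmem P).mp hP).resolve_left hne
  have htf' : ∀ P ∈ H, IsOfFinAddOrder P → P = 0 := by
    intro P hP hfin
    by_contra hne
    exact (isAdmissible_of_satisfiesLocalConditions (hslc P hP hne)).1 hfin
  have hpar : ∀ P ∈ H, ∀ Q ∈ H, P ≠ 0 → Q ≠ 0 → P - Q ≠ 0 → P + Q ≠ 0 →
      q (P + Q) + q (P - Q) = 2 * q P + 2 * q Q := by
    intro P hP Q hQ hP0 hQ0 hsub hadd
    have hP' := hslc P hP hP0
    have hQ' := hslc Q hQ hQ0
    rcases P with _ | ⟨x₁, y₁, h₁⟩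
    · exact (W.not_satisfiesLocalConditions_zero 2 hP').elim
    rcases Q with _ | ⟨x₂, y₂, h₂⟩
    · exact (W.not_satisfiesLocalConditions_zero 2 hQ').elim
    rcases hS : (.some x₁ y₁ h₁ : W.toAffine.Point) + .some x₂ y₂ h₂ with _ | ⟨x₃, y₃, h₃⟩
    · exact (hadd hS).elim
    rcases hD : (.some x₁ y₁ h₁ : W.toAffine.Point) - .some x₂ y₂ h₂ with _ | ⟨x₄, y₄, h₄⟩
    · exact (hsub hD).elim
    rw [hS, hD]
    exact sigmaSqZero_height_parallelogram_two W ha1 Sq h0 h1 h2 h3 hODE h₁ h₂ h₃ h₄ hP' hQ' hS hD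
  have hfull := Literature.NumberTheory.EllipticCurves.parallelogram_of_generic H htf' q rfl hpar
  obtain ⟨B, hsymm, htors, hdiag⟩ := Literature.NumberTheory.EllipticCurves.exists_pairing_of_parallelogram H _ hfull
  exact ⟨⟨B, hsymm, fun P Q hP => htors P Q hP⟩, fun h hP => hdiag _ ((hmem _).mpr (Or.inr hP))⟩

end NaiveSigmaLogAtTwo

end Summit.BirchSwinnertonDyer.BirchSwinnertonDyer.Theorems
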